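import Summits.CriticalPhenomena.Ising3D.ExclusionSentencesControl2DTrgGamma

/-!
# Exclusion sentences — 2D-control instance of the FULL `TRG` checker, part 2 of 2: parts `4–7`, the assembled
sentence and the printed shape (cell `pub-ising3x`, seat recog-1)

HONEST FRAMING: lottery ticket; floor = tightest certified 3D Ising CFT bounds; no exact-solution
claim without a proof.

See `ExclusionSentencesControl2DTrgGamma.lean` (part 1: the tuple list `controlSigmaTrgGEx`, parts `0–3`,
non-vacuity).  Result: `trgFull_control_sigma : trgFullExcluded 17 32 (1/8 − 10⁻⁶) (1/8 + 10⁻⁶) controlSigmaTrgGEx`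
— within `10⁻⁶` of `Δ_σ = 1/8` the WHOLE FAMILIES-v1 family `TRG` has exactly the four listed members
(`control_sigma_trgFull`).  Together with `control_sigma_trg_lin` (`ExclusionSentencesControl2DZeta.lean`) and the
rational / Kac / algebraic control files, every FAMILIES-v1 family now has a kernel sentence at the 2D control.
No 3D digit is used anywhere.
-/

namespace Summit.CriticalPhenomena.Ising3D

/-- Part 4 (classes `Γ(¼)⁴`, `Γ(⅓)^{−3}`) on `[1/8 − 10⁻⁶, 1/8 + 10⁻⁶]`. -/
theorem trgFull_control_sigma_p4 :
    trgFullPart 17 32 4 (1 / 8 - 1 / 10 ^ 6) (1 / 8 + 1 / 10 ^ 6) controlSigmaTrgGEx = true := by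
  decide +kernel

/-- Part 5 (classes `Γ(⅓)^{−2}`, `Γ(⅓)^{−1}`). -/
theorem trgFull_control_sigma_p5 :
    trgFullPart 17 32 5 (1 / 8 - 1 / 10 ^ 6) (1 / 8 + 1 / 10 ^ 6) controlSigmaTrgGEx = true := by
  decide +kernel

/-- Part 6 (classes `Γ(⅓)¹`, `Γ(⅓)²`). -/
theorem trgFull_control_sigma_p6 :
    trgFullPart 17 32 6 (1 / 8 - 1 / 10 ^ 6) (1 / 8 + 1 / 10 ^ 6) controlSigmaTrgGEx = true := by
  decide +kernel

/-- Part 7 (class `Γ(⅓)³`). -/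
theorem trgFull_control_sigma_p7 :
    trgFullPart 17 32 7 (1 / 8 - 1 / 10 ^ 6) (1 / 8 + 1 / 10 ^ 6) controlSigmaTrgGEx = true := by
  decide +kernel

/-- **Full-TRG sentence at the 2D control**: the four listed tuples are the COMPLETE member list of FAMILIES-v1
`TRG` (`D ≤ 17`, `h ≤ 32`) within `10⁻⁶` of `1/8`. -/
theorem trgFull_control_sigma :
    trgFullExcluded 17 32 (1 / 8 - 1 / 10 ^ 6) (1 / 8 + 1 / 10 ^ 6) controlSigmaTrgGEx = true :=
  trgFullExcluded_of_parts trgFull_control_sigma_p0 trgFull_control_sigma_p1 trgFull_control_sigma_p2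
    trgFull_control_sigma_p3 trgFull_control_sigma_p4 trgFull_control_sigma_p5 trgFull_control_sigma_p6
    trgFull_control_sigma_p7

/-- Printed shape: a real within `10⁻⁶` of `1/8` that is a member of the whole TRG table equals one of the four
listed monomials. -/
theorem control_sigma_trgFull {x : ℝ}
    (hx : ((1 / 8 - 1 / 10 ^ 6 : ℚ) : ℝ) ≤ x ∧ x ≤ ((1 / 8 + 1 / 10 ^ 6 : ℚ) : ℝ)) (hm : x ∈ trgFullFamily 17 32) :
    ∃ e ∈ controlSigmaTrgGEx, x = trgGTupleVal e :=
  trgFullExcluded_sound trgFull_control_sigma hx hm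

end Summit.CriticalPhenomena.Ising3D
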